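import Summits.BirchSwinnertonDyer.BirchSwinnertonDyer.Theorems.SignedLowerHalvesSmallImageLowerHalfBothSignsRttKanGoodDepleteData
import Summits.BirchSwinnertonDyer.BirchSwinnertonDyer.Theorems.KimAtThreeDeepLowerOffStratumLevelLoweringDepleteConditionOne
import Literature.NumberTheory.EllipticCurves.NewformsDepletion
import HarnessLib

/-!
# Route `SignedLowerHalves`, crux L `SmallImageLowerHalfBothSigns` (item stmt-BirchSwinnertonDyer-23599), line `rtt_w3`,
# stub Kan₂ `stub_thetaLayerLambda_ns` — brick K2b (part 1): ONE depletion step — `q`-expansions and PLUS SYMBOLS of the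
# good-prime depletion `ι₁ − a_ℓι_ℓ + ℓι_{ℓ²}` and of the level-prime depletion `ι₁ − a_ℓι_ℓ`

Width seat `bsd-line-slh-p3-w3` g11 under LEAD `cruxlead-stmt-BirchSwinnertonDyer-23599` g0 (cell `bsd-ssimc`). ROUTE-INDEPENDENT
helper (`--supports stmt-BirchSwinnertonDyer-23599`); THEOREMS ONLY — no definition, no named fact, no `sorry`; closes nothing;
BSD is not proved by any of this.

WHAT. For the multi-prime induction building the `S₀`-depleted eigenform at the EXACT level (part 2), the one-step facts:
* §1 `plusSymbol_iota'` — `[x]⁺_{ι_d h} = d⁻¹ [d x]⁺_h` (Cremona §2.4, from the tree's `DepletedForm.modularSymbol_iota`);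
  `plusSymbol_add'`, `plusSymbol_smul'`, `plusSymbol_sub'` — linearity in the form.
* §2 (good prime `ℓ ∤ N`, `D = ι₁ − aι_ℓ + ℓι_{ℓ²}`, level `Nℓ²`): `plusSymbol_goodDeplete` —
  `[x]⁺_{D v} = [x]⁺_v − (a/ℓ)[ℓx]⁺_v + ℓ⁻¹[ℓ²x]⁺_v`; `cuspCoeff_goodDeplete_eq` — `aₙ(D G) = 𝟙_{ℓ∤n} aₙ(G)` for a normalised
  `T_ℓ`-eigenform `G` with `a = a_ℓ(G)` (`U_ℓ D G = 0`).
* §3 (level prime `ℓ ∣ N`, `S = ι₁ − aι_ℓ`, level `Nℓ`): `plusSymbol_levelDeplete` — `[x]⁺_{S v} = [x]⁺_v − (a/ℓ)[ℓx]⁺_v`;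
  `cuspCoeff_levelDeplete_eq` — `aₙ(S G) = 𝟙_{ℓ∤n} aₙ(G)` (`U_ℓ S G = 0`).
* §4 `sum_range_three_eulerCoeff` — the common shape `∑_{j<3} c_j ℓ^{−j} F(j)` with `c = (1, −a, b)` the coefficients of
  `1 − aX + bX²` (so that §2/§3 read as the `j`-sums consumed by the depletion identity `…RttKanLayerDepletion`).

References: [CremonaAlgorithms1997] §2.4; [DiamondShurman2005] Prop. 5.6.2, §5.7; [GreenbergVatsal2000] §1 (8); [AtkinLehner1970] Thm. 3–5.
-/

set_option autoImplicit false
-- D-0017: single-problem summit, the namespace repeats the problem name by design.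
set_option linter.dupNamespace false

noncomputable section

open scoped MatrixGroups ModularForm Classical NNReal

open CongruenceSubgroup Literature.NumberTheory.EllipticCurves Literature.NumberTheory.EllipticCurves.ModularForms Polynomial
open UpperHalfPlane hiding I

namespace Summit.BirchSwinnertonDyer.BirchSwinnertonDyer.Theorems.SmallImageRttKan

open Summit.BirchSwinnertonDyer.BirchSwinnertonDyer.Theorems.KimAtThreeDeepLowerOffStratumLevelLoweringDepleteConditionOne
  (heckeT_deplete_of_heckeT_eq_smul)

/-! ### §1 Plus symbols of level-raised forms -/

section Symbols

variable {M N' d : ℕ} [NeZero d] (h : M * d ∣ N')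

omit [NeZero d] in
/-- `[x]⁺` is additive in the form. [folklore] -/
theorem plusSymbol_add' {N : ℕ} [NeZero N] (h₁ h₂ : CuspForm (Gamma0 N) 2) (x : ℚ) :
    plusSymbol (h₁ + h₂) x = plusSymbol h₁ x + plusSymbol h₂ x := by
  simp only [plusSymbol, modularSymbol_add]; ring

omit [NeZero d] in
/-- `[x]⁺` is homogeneous in the form. [folklore] -/
theorem plusSymbol_smul' {N : ℕ} (c : ℂ) (h₁ : CuspForm (Gamma0 N) 2) (x : ℚ) :
    plusSymbol (c • h₁) x = c * plusSymbol h₁ x := by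
  simp only [plusSymbol, modularSymbol_smul]; ring

omit [NeZero d] in
/-- `[x]⁺` of a difference. [folklore] -/
theorem plusSymbol_sub' {N : ℕ} [NeZero N] (h₁ h₂ : CuspForm (Gamma0 N) 2) (x : ℚ) :
    plusSymbol (h₁ - h₂) x = plusSymbol h₁ x - plusSymbol h₂ x := by
  have e : h₁ - h₂ = h₁ + (-1 : ℂ) • h₂ := by rw [neg_one_smul, sub_eq_add_neg]
  rw [e, plusSymbol_add', plusSymbol_smul']; ring

/-- **`[x]⁺_{ι_d h} = d⁻¹ · [d x]⁺_h`** (`(ι_d h)(z) = h(dz)`; Cremona §2.4 — from the tree's `DepletedForm.modularSymbol_iota`).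
[cite: CremonaAlgorithms1997, §2.4] -/
theorem plusSymbol_iota' (g : CuspForm (Gamma0 M) 2) (x : ℚ) :
    plusSymbol (iota M N' d 2 h g) x = (d : ℂ)⁻¹ * plusSymbol g (d * x) := by
  simp only [plusSymbol, DepletedForm.modularSymbol_iota h]
  rw [show (d : ℚ) * -x = -(d * x) by ring]
  ring

end Symbols

/-! ### §2 The good-prime depletion: plus symbol and `q`-expansion -/

section Good

variable {N N' ℓ : ℕ} [NeZero N] [NeZero N'] [NeZero ℓ]
  (h1 : N * 1 ∣ N') (hℓ1 : N * ℓ ∣ N') (hℓ2 : N * (ℓ * ℓ) ∣ N')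

omit [NeZero N] in
/-- **Plus symbol of the good-prime depletion**: `[x]⁺_{ι₁v − aι_ℓv + ℓι_{ℓ²}v} = [x]⁺_v − (a/ℓ)·[ℓx]⁺_v + ℓ⁻¹·[ℓ²x]⁺_v`
(the depletion operator `1 − aℓ⁻¹[ℓ] + ℓ·ℓ⁻²[ℓ²]` on symbols). [cite: CremonaAlgorithms1997, §2.4] [cite: GreenbergVatsal2000, §1 p. 9 (display (8))] -/
theorem plusSymbol_goodDeplete (hℓ : ℓ.Prime) (v : CuspForm (Gamma0 N) 2) (a : ℂ) (x : ℚ) :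
    plusSymbol (iota N N' 1 2 h1 v - a • iota N N' ℓ 2 hℓ1 v + (ℓ : ℂ) • iota N N' (ℓ * ℓ) 2 hℓ2 v) x =
      plusSymbol v x - a / ℓ * plusSymbol v (ℓ * x) + (ℓ : ℂ)⁻¹ * plusSymbol v ((ℓ * ℓ : ℕ) * x) := by
  have hℓ0 : (ℓ : ℂ) ≠ 0 := by exact_mod_cast hℓ.ne_zero
  rw [plusSymbol_add', plusSymbol_sub', plusSymbol_smul', plusSymbol_smul', plusSymbol_iota', plusSymbol_iota',
    plusSymbol_iota', Nat.cast_one, inv_one, one_mul, Nat.cast_one, one_mul, Nat.cast_mul]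
  field_simp

variable {G : CuspForm (Gamma0 N) 2} (hGeig : IsHeckeEigenform G) (hGnorm : IsNormalized G)
include hGeig hGnorm

/-- **`q`-expansion of the good-prime depletion of a normalised eigenform**: `aₙ(D G) = 0` if `ℓ ∣ n`, `aₙ(G)` otherwise
(`U_ℓ D G = 0`, so `a_{ℓm}(D G) = a_m(U_ℓ D G) = 0`; for `ℓ ∤ n` the `ι_ℓ`, `ι_{ℓ²}` terms do not contribute). [cite: DiamondShurman2005, Prop. 5.6.2 and §5.7] -/
theorem cuspCoeff_goodDeplete_eq (hN' : N' = N * (ℓ * ℓ)) (hℓ : ℓ.Prime) (hℓN : ¬ ℓ ∣ N) (n : ℕ) :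
    cuspCoeff (iota N N' 1 2 h1 G - cuspCoeff G ℓ • iota N N' ℓ 2 hℓ1 G + (ℓ : ℂ) • iota N N' (ℓ * ℓ) 2 hℓ2 G) n =
      if ℓ ∣ n then 0 else cuspCoeff G n := by
  by_cases hℓn : ℓ ∣ n
  · obtain ⟨m, rfl⟩ := hℓn
    rw [if_pos (dvd_mul_right ℓ m)]
    have hv : heckeT (Gamma0 N) 2 ℓ G = cuspCoeff G ℓ • G := by
      rw [heckeT_eq_heckeEigenvalue_smul G ℓ (hGeig ℓ hℓ), heckeEigenvalue_eq_coeff_of_isNormalized hGnorm hℓ (hGeig ℓ hℓ)]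
      rfl
    have hU := heckeT_goodDeplete_self h1 hℓ1 hℓ2 hN' hℓ hℓN hv
    have hℓN' : ℓ ∣ N' := by rw [hN']; exact (dvd_mul_right ℓ ℓ).trans (dvd_mul_left _ N)
    have e0 : cuspCoeff (0 : CuspForm (Gamma0 N') 2) m = 0 := by
      rw [cuspCoeff, CuspForm.coe_zero, UpperHalfPlane.qExpansion_zero, map_zero]
    have e := congrArg (fun φ : CuspForm (Gamma0 N') 2 ↦ cuspCoeff φ m) hU
    rw [e0, cuspCoeff, qExpansion_coeff_heckeT_holds N' 2 _ ℓ hℓ m, if_pos hℓN', add_zero] at e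
    exact e
  · have hℓℓn : ¬ ℓ * ℓ ∣ n := fun h' ↦ hℓn ((dvd_mul_right ℓ ℓ).trans h')
    rw [cuspCoeff_goodDeplete, if_neg hℓn, if_neg hℓℓn, if_neg hℓn, mul_zero, mul_zero, sub_zero, add_zero]

end Good

/-! ### §3 The level-prime depletion `ι₁ − aι_ℓ` (`ℓ ∣ N`): plus symbol and `q`-expansion -/

section Level

variable {N ℓ : ℕ} [NeZero N] [NeZero ℓ] (h1 : N * 1 ∣ N * ℓ) (hℓℓ : N * ℓ ∣ N * ℓ)

/-- Plus symbol of `ι₁v − aι_ℓv`: `[x]⁺ = [x]⁺_v − (a/ℓ)[ℓx]⁺_v` (the tree's `plusSymbol_stab`). [cite: CremonaAlgorithms1997, §2.4] -/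
theorem plusSymbol_levelDeplete (v : CuspForm (Gamma0 N) 2) (a : ℂ) (x : ℚ) :
    plusSymbol (iota N (N * ℓ) 1 2 h1 v - a • iota N (N * ℓ) ℓ 2 hℓℓ v) x =
      plusSymbol v x - a / ℓ * plusSymbol v (ℓ * x) :=
  KimAtThreeDeepLowerOffStratumLevelLoweringVatsalStab.plusSymbol_stab v a h1 hℓℓ x

variable {G : CuspForm (Gamma0 N) 2} (hGeig : IsHeckeEigenform G) (hGnorm : IsNormalized G)
include hGeig hGnorm

/-- **`q`-expansion of the level-prime depletion of a normalised eigenform** (`ℓ ∣ N`): `aₙ(ι₁G − a_ℓ(G)ι_ℓG) = 0` if `ℓ ∣ n`,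
`aₙ(G)` otherwise (`U_ℓ` kills the depletion: the tree's `heckeT_deplete_of_heckeT_eq_smul`). [cite: DiamondShurman2005, Prop. 5.6.2 and §5.7] -/
theorem cuspCoeff_levelDeplete_eq (hℓ : ℓ.Prime) (hℓN : ℓ ∣ N) (n : ℕ) :
    cuspCoeff (iota N (N * ℓ) 1 2 h1 G - cuspCoeff G ℓ • iota N (N * ℓ) ℓ 2 hℓℓ G) n =
      if ℓ ∣ n then 0 else cuspCoeff G n := by
  by_cases hℓn : ℓ ∣ n
  · obtain ⟨m, rfl⟩ := hℓn
    rw [if_pos (dvd_mul_right ℓ m)]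
    have hv : heckeT (Gamma0 N) 2 ℓ G = cuspCoeff G ℓ • G := by
      rw [heckeT_eq_heckeEigenvalue_smul G ℓ (hGeig ℓ hℓ), heckeEigenvalue_eq_coeff_of_isNormalized hGnorm hℓ (hGeig ℓ hℓ)]
      rfl
    have hU := heckeT_deplete_of_heckeT_eq_smul h1 hℓℓ hℓ hℓN hv (cuspCoeff G ℓ)
    rw [sub_self, zero_smul] at hU
    have e0 : cuspCoeff (0 : CuspForm (Gamma0 (N * ℓ)) 2) m = 0 := by
      rw [cuspCoeff, CuspForm.coe_zero, UpperHalfPlane.qExpansion_zero, map_zero]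
    have e := congrArg (fun φ : CuspForm (Gamma0 (N * ℓ)) 2 ↦ cuspCoeff φ m) hU
    rw [e0, cuspCoeff, qExpansion_coeff_heckeT_holds (N * ℓ) 2 _ ℓ hℓ m, if_pos (dvd_mul_left ℓ N), add_zero] at e
    exact e
  · rw [KimAtThreeDeepLowerOffStratumLevelLoweringVatsalStab.cuspCoeff_stab, if_neg hℓn, if_neg hℓn, mul_zero, sub_zero]

end Level

/-! ### §4 The `j`-sum shape `∑_{j<3} c_j ℓ^{−j} F(j)` of one depletion step -/

section Shape

/-- The `j`-sum over the coefficients `(1, −a, b)` of `1 − aX + bX²`: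
`∑_{j<3} coeff_j(1 − aX + bX²)·c^j·F(j) = F(0) − a c F(1) + b c² F(2)`. [folklore] -/
theorem sum_range_three_eulerCoeff (a b c : ℂ) (F : ℕ → ℂ) :
    ∑ j ∈ Finset.range 3, ((1 - C a * X + C b * X ^ 2 : ℂ[X]).coeff j * c ^ j) * F j =
      F 0 - a * c * F 1 + b * c ^ 2 * F 2 := by
  simp only [Finset.sum_range_succ, Finset.sum_range_zero, zero_add, coeff_add, coeff_sub, coeff_one, coeff_C_mul,
    coeff_X_pow, coeff_X, pow_zero, pow_one]
  norm_num
  ring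

end Shape

end Summit.BirchSwinnertonDyer.BirchSwinnertonDyer.Theorems.SmallImageRttKan

end
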